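import Summits.HodgeConjecture.HodgeConjecture.Theorems.HLiu418SeesawDetectionAlbaneseCmp
import Summits.HodgeConjecture.CorCM.HypLiu418.A3Liu418GSInstance
import Summits.HodgeConjecture.CorCM.D2Bridge.BettiConjugateEmbedding
import Literature.AlgebraicGeometry.Motives.BaseChangeAlgebraicExtension
import HarnessLib

/-!
# Crux `HLiu418`, line `F0_AlbCm`, stub `stub_S1_betti` — leg M5-tr: the GS Betti levels `H¹_{B,ι₁}(A_K, ℂ)` EMBED Hecke-naturally
# into the record's `H¹((M_K ⊗_{F,ι₁} ℂ)(ℂ); ℂ)`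

Floor-0 programme P5 (Alb-CM), seat F0P5-p01 (g0); item stmt-HodgeConjecture-24832 (`HCCMUnconditional.HLiu418`), sub-sub-line
`Cruxes/HLiu418/Lines/F0_AlbCmS1Betti` (letter `S1RealisationShape` ∕ its levelwise form `S1LevelRealisationShape`).  THEOREMS ONLY
(no `def`, no named fact, no instance, no `sorry`).  HC_CM is proved only modulo the 7 printed citations until rung 0 closes; this file
closes nothing by itself.

THE TRANSPORT (M4→M5 memo A-p14 (g15) a52be1d5 §1 (a)(b)).  The §4.2 datum of the record curve `S : RecordSystemGS F J⋆ ι₁ K₀` is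
`C := sec42DataGS S h4 isoₛ` with levels `C.X K = M_K ⊗_{F,c} F` (the `c`-CONJUGATE model, ★ `sec42DataGS_X` rfl) and Albanese varieties
`A_K := Alb(X_K)`; its Betti levels along `ι₁` are `C.bettiH1 ι₁ K = H¹((A_K ⊗_{F,ι₁} ℂ)(ℂ); ℂ)`, with the Hecke translates acting by
`Alb(T_g)^*` (`T.albTr`, `T := sec42HeckeTranslatesGS …`, `T.tr g = (T_g) ⊗_c F` for the record's translate `T_g = recordHeckeTranslateGS …`,
★ `sec42HeckeTranslatesGS_tr` rfl).  The automorphic realisation (M1∕M1b∕M3∕M4) lives on the record's OWN fibre `M_K ⊗_{F,ι₁} ℂ`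
(`pts`, `hol`, `pieces` along `ι₁`).  This file supplies, level by level, an INJECTIVE `ℂ`-linear map
`tr_K : H¹_{B,ι₁}(A_K, ℂ) → H¹((M_K ⊗_{F,ι₁} ℂ)(ℂ); ℂ)` intertwining `Alb(T_g)^*` with `(T_g ⊗_{ι₁} ℂ)(ℂ)^*`, as the composite of
three Hecke-natural injections, all ★:
* (1) [Liu2021, Lem. 2.4 (1)] `albaneseH1Cmp X_K A_K = ((α_{X_K})_x)^*` (★ `CorCM/HypLiu418/AlbaneseH1ComparisonOfLemma24`), INJECTIVE for a
  tower of CURVES (★ `sec42Data_injective_albaneseH1Cmp_of_n_eq_two`, `n = 2` by `rfl`), natural for the α-compatible pair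
  `(T.tr g, ∇, Alb(T_g))` (★ `albaneseH1Cmp_natural` fed with ★ `Nabla.map_incl`, ★ `HeckeTranslates.α_albTr`) — `albaneseH1Cmp_albTr`;
* (2) the CONJUGATE-MODEL identification `(M_K ⊗_c F) ⊗_{ι₁} ℂ ≅ M_K ⊗_{ῑ₁} ℂ`, `ῑ₁ = conj ∘ ι₁ = ι₁ ∘ c` (★ `baseChangeHomObjIsoOfComp`,
  natural in `M_K`: ★ `baseChangeHomObjIsoOfComp_comm`) read on `H¹` — `complexBetti_map_conjModelIso_inv_natural`;
* (3) complex CONJUGATION OF POINTS `(M_K ⊗_{ι₁} ℂ)(ℂ) ≃ₜ (M_K ⊗_{ῑ₁} ℂ)(ℂ)` (★ `D2Bridge.conjComplexPoints`, natural: ★ `conjPoints_natural`)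
  read on `H¹(−; ℂ)` — `singularCohomology_map_conjComplexPoints_natural`.
HEAD: `exists_bettiLevelRecordTransport` — `∃ tr, (∀ K, Injective (tr K)) ∧ ∀ g K K' h y, tr K (Alb(T_g)^* y) = (T_g ⊗_{ι₁} ℂ)(ℂ)^* (tr K' y)`.
With it, the letter `S1LevelRealisationShape` (hence `S1RealisationShape`, by the ★-pending gluing `BettiPinningRealisation`) reduces to a
record-side levelwise realisation of `H¹((M_K ⊗_{ι₁} ℂ)(ℂ); ℂ)` in `cohForms₂ 𝔣` compatible with the record's translates (M5-rec).
No Hodge types cross this transport (the untyped letter needs none; the `(1,0) ↔ (0,1)` swap of step (3) is F0P5-p04's (α) bit).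

## References
* [Liu2021] Y. Liu, *Fourier–Jacobi cycles and arithmetic relative trace formula*, Camb. J. Math. 9 (2021): Lem. 2.4 (1) (FJcycle.tex
  l. 1210–1228), Def. 2.3 (l. 1202–1208), §4.2 (l. 2064–2081), proof of Thm. 4.15 (l. 2193–2213).
* [Milne2005ShimuraVarieties] J. S. Milne, *Introduction to Shimura varieties* (2005), §13 p. 118 (Hecke translates `T(g)`), Thm. 13.6.
* [Deligne1982] P. Deligne, *Hodge cycles on abelian varieties*, LNM 900 (1982), §1 (conjugate varieties, `σ`-twisted points).
* [HatcherAT2002] A. Hatcher, *Algebraic Topology* (2002), §3.1 (functoriality of singular cohomology).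
-/

set_option autoImplicit false
set_option linter.dupNamespace false

noncomputable section

open CategoryTheory CategoryTheory.Limits AlgebraicGeometry NumberField Function
open Literature.AlgebraicGeometry.Motives Literature.AlgebraicGeometry.HodgeTheory
open Literature.AlgebraicTopology.SingularHomology
open Literature.AlgebraicGeometry.ShimuraVarieties.UnitaryCanonicalModel
open Literature.NumberTheory.Automorphic Literature.NumberTheory.Automorphic.UnitaryGroup
open Literature.NumberTheory.Automorphic.Liu2021 Literature.NumberTheory.Automorphic.Liu2021.AppendixC
open Summit.HodgeConjecture.CorCM (CMField)
open Summit.HodgeConjecture.CorCM.Lines.A3Liu418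
open Summit.HodgeConjecture.CorCM.D2Bridge

namespace Summit.HodgeConjecture.HodgeConjecture.Cruxes.HLiu418.BettiLevelRecordTransport

/-! ## §1 Step (1): Lemma 2.4 (1) on the GS levels, Hecke-natural -/

section GS

variable {F : CMField} {ι₁ : F →+* ℂ} {Jstar : Matrix (Fin 2) (Fin 2) (F : Type)}
  {K₀ : C5.OpenCompactSubgroup ↥(finAdelic ↥(maximalRealSubfield (F : Type)) (F : Type) (IsCMField.complexConj (F : Type)) 2 Jstar)}
  (S : RecordSystemGS (F : Type) Jstar ι₁ K₀) (hU7ₛ : S.HeckeTranslateDefinedOver) (h4 : 4 ≤ Module.finrank ℚ (F : Type)) (isoₛ : ℕ → Prop)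

/-- **Step (1), naturality**: `albaneseH1Cmp X_K A_K (Alb(T_g)^* y) = (T.tr g ⊗_{ι₁} ℂ)(ℂ)^* (albaneseH1Cmp X_{K'} A_{K'} y)` — ★
`albaneseH1Cmp_natural` at the α-compatible pair `(T.tr g, ∇(T.tr g), Alb(T_g))` (★ `Nabla.map_incl`, ★ `HeckeTranslates.α_albTr`; the levels
are smooth projective curves, ★ `CompactifiedSystem.smooth_X` ∕ `projective_X`). [cite: Liu2021, Lem. 2.4 (1) with Def. 2.3; §4.2 l. 2074] -/
theorem albaneseH1Cmp_albTr (g : (sec42DataGS S h4 isoₛ).G) (K K' : C5.SmallLevel K₀) (h : C5.HeckeLE g K K')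
    (y : (sec42DataGS S h4 isoₛ).bettiH1 ι₁ K') :
    letI : Algebra (F : Type) ℂ := algebraAlong (F : Type) ι₁
    albaneseH1Cmp ((sec42DataGS S h4 isoₛ).X K) ((sec42DataGS S h4 isoₛ).alb K)
        (bettiPullAlong ι₁ ((sec42HeckeTranslatesGS S hU7ₛ h4 isoₛ).albTr g K K' h) y) =
      schemeBettiPullAlong ι₁ ((sec42HeckeTranslatesGS S hU7ₛ h4 isoₛ).tr g K K' h)
        (albaneseH1Cmp ((sec42DataGS S h4 isoₛ).X K') ((sec42DataGS S h4 isoₛ).alb K') y) := by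
  letI : Algebra (F : Type) ℂ := algebraAlong (F : Type) ι₁
  exact albaneseH1Cmp_natural ((sec42DataGS S h4 isoₛ).alb K) ((sec42DataGS S h4 isoₛ).alb K') _ _
    ((sec42DataGS S h4 isoₛ).cpt.smooth_X K) ((sec42DataGS S h4 isoₛ).cpt.projective_X K)
    ((sec42DataGS S h4 isoₛ).cpt.smooth_X K') ((sec42DataGS S h4 isoₛ).cpt.projective_X K')
    ((sec42HeckeTranslatesGS S hU7ₛ h4 isoₛ).tr g K K' h) _ ((sec42HeckeTranslatesGS S hU7ₛ h4 isoₛ).albTr g K K' h)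
    (((sec42DataGS S h4 isoₛ).alb K).nabla.map_incl ((sec42DataGS S h4 isoₛ).alb K').nabla
      ((sec42HeckeTranslatesGS S hU7ₛ h4 isoₛ).tr g K K' h))
    ((sec42HeckeTranslatesGS S hU7ₛ h4 isoₛ).α_albTr g K K' h) y

/-- **Step (1), injectivity** for the curve tower (`n = 2` by `rfl`): ★ `sec42Data_injective_albaneseH1Cmp_of_n_eq_two`.
[cite: Liu2021, Lem. 2.4 (1) (FJcycle.tex l. 1210–1213)] -/
theorem injective_albaneseH1Cmp (K : C5.SmallLevel K₀) :
    letI : Algebra (F : Type) ℂ := algebraAlong (F : Type) ι₁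
    Function.Injective (albaneseH1Cmp ((sec42DataGS S h4 isoₛ).X K) ((sec42DataGS S h4 isoₛ).alb K)) :=
  sec42Data_injective_albaneseH1Cmp_of_n_eq_two (sec42DataGS S h4 isoₛ) rfl K

end GS

/-! ## §2 Step (2): the conjugate-model identification `(Y ⊗_c F) ⊗_{ι₁} ℂ ≅ Y ⊗_{ῑ₁} ℂ` on `H¹` -/

section ConjModel

variable (L : Type) [Field L] [NumberField L] [IsCMField L] (ι₁ : L →+* ℂ)

/-- `ι₁ ∘ c = conj ∘ ι₁ = ῑ₁` for the complex conjugation `c` of a CM field. [cite: Deligne1982, §1] -/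
theorem comp_cmConjRingHom_eq_conjEmb : ι₁.comp (cmConjRingHom L) = conjEmb ι₁ :=
  RingHom.ext fun x => by
    simp only [RingHom.coe_comp, Function.comp_apply, embedding_cmConjRingHom]

/-- **Step (2), naturality on `H¹`**: for `f : Y ⟶ Y'` over `L` and the identifications `Θ_Y : (Y ⊗_c L) ⊗_{ι₁} ℂ ≅ Y ⊗_{ῑ₁} ℂ`
(★ `baseChangeHomObjIsoOfComp`), `(Θ_Y⁻¹)^* ∘ ((f ⊗_c L) ⊗_{ι₁} ℂ)^* = (f ⊗_{ῑ₁} ℂ)^* ∘ (Θ_{Y'}⁻¹)^*` (★ `baseChangeHomObjIsoOfComp_comm`,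
contravariance of `complexBetti.map`). [cite: Deligne1982, §1] [cite: HatcherAT2002, §3.1] -/
theorem complexBetti_map_conjModelIso_inv_natural {Y Y' : SchemeOver L} (f : Y ⟶ Y') (i : ℕ)
    (z : complexBetti ((baseChangeHom ι₁).obj ((baseChangeHom (cmConjRingHom L)).obj Y')) i) :
    (complexBetti.map (baseChangeHomObjIsoOfComp (cmConjRingHom L) ι₁ (conjEmb ι₁)
        (comp_cmConjRingHom_eq_conjEmb L ι₁) Y).inv i).hom
      ((complexBetti.map ((baseChangeHom ι₁).map ((baseChangeHom (cmConjRingHom L)).map f)) i).hom z) =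
    (complexBetti.map ((baseChangeHom (conjEmb ι₁)).map f) i).hom
      ((complexBetti.map (baseChangeHomObjIsoOfComp (cmConjRingHom L) ι₁ (conjEmb ι₁)
        (comp_cmConjRingHom_eq_conjEmb L ι₁) Y').inv i).hom z) := by
  have hΘ := baseChangeHomObjIsoOfComp_comm (cmConjRingHom L) ι₁ (conjEmb ι₁) (comp_cmConjRingHom_eq_conjEmb L ι₁) f
  -- inverses: `Θ_Y⁻¹ ≫ (f ⊗_c L) ⊗_{ι₁} ℂ = f ⊗_{ῑ₁} ℂ ≫ Θ_{Y'}⁻¹`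
  have hinv : (baseChangeHomObjIsoOfComp (cmConjRingHom L) ι₁ (conjEmb ι₁) (comp_cmConjRingHom_eq_conjEmb L ι₁) Y).inv ≫
      (baseChangeHom ι₁).map ((baseChangeHom (cmConjRingHom L)).map f) =
      (baseChangeHom (conjEmb ι₁)).map f ≫
        (baseChangeHomObjIsoOfComp (cmConjRingHom L) ι₁ (conjEmb ι₁) (comp_cmConjRingHom_eq_conjEmb L ι₁) Y').inv := by
    rw [Iso.inv_comp_eq, ← Category.assoc, Iso.eq_comp_inv]
    exact hΘ
  have hmap := congrArg (fun φ => (complexBetti.map φ i).hom z) hinv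
  simp only [complexBetti.map_comp, ModuleCat.hom_comp, LinearMap.comp_apply] at hmap
  exact hmap

/-- **Step (2), injectivity**: `(Θ_Y⁻¹)^*` is injective (`Θ_Y⁻¹ ≫ Θ_Y = 𝟙`). [cite: HatcherAT2002, §3.1] -/
theorem injective_complexBetti_map_conjModelIso_inv (Y : SchemeOver L) (i : ℕ) :
    Function.Injective (complexBetti.map (baseChangeHomObjIsoOfComp (cmConjRingHom L) ι₁ (conjEmb ι₁)
        (comp_cmConjRingHom_eq_conjEmb L ι₁) Y).inv i).hom := by
  set Θ := baseChangeHomObjIsoOfComp (cmConjRingHom L) ι₁ (conjEmb ι₁) (comp_cmConjRingHom_eq_conjEmb L ι₁) Y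
  intro z z' hzz'
  have h := congrArg (complexBetti.map Θ.hom i).hom hzz'
  have hid : complexBetti.map Θ.inv i ≫ complexBetti.map Θ.hom i = 𝟙 _ := by
    rw [← complexBetti.map_comp, Iso.hom_inv_id, complexBetti.map_id]
  have hz : (complexBetti.map Θ.hom i).hom ((complexBetti.map Θ.inv i).hom z) = z := by
    rw [← LinearMap.comp_apply, ← ModuleCat.hom_comp, hid]; rfl
  have hz' : (complexBetti.map Θ.hom i).hom ((complexBetti.map Θ.inv i).hom z') = z' := by
    rw [← LinearMap.comp_apply, ← ModuleCat.hom_comp, hid]; rfl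
  rw [hz, hz'] at h
  exact h

end ConjModel

/-! ## §3 Step (3): complex conjugation of points on `H¹(−; ℂ)` -/

section ConjPoints

variable {L : Type} [Field L] (ι₁ : L →+* ℂ)

/-- **Step (3), naturality on `H¹(−; ℂ)`**: for `f : Y ⟶ Y'` over `L`, pull-back along complex conjugation of points
`κ_Y : (Y ⊗_{ι₁} ℂ)(ℂ) ≃ₜ (Y ⊗_{ῑ₁} ℂ)(ℂ)` intertwines `(f ⊗_{ῑ₁} ℂ)(ℂ)^*` with `(f ⊗_{ι₁} ℂ)(ℂ)^*` (★ `conjPoints_natural`; the `ℂ`-coefficient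
twin of ★ `bettiConjIso_natural`). [cite: Deligne1982, §1] [cite: HatcherAT2002, §3.1] -/
theorem singularCohomology_map_conjComplexPoints_natural {Y Y' : SchemeOver L} (f : Y ⟶ Y') (i : ℕ)
    (z : complexBetti ((baseChangeHom (conjEmb ι₁)).obj Y') i) :
    (singularCohomology.map ℂ ℂ (conjComplexPoints ι₁ Y : C(_, _)) i).hom
        ((complexBetti.map ((baseChangeHom (conjEmb ι₁)).map f) i).hom z) =
      (complexBetti.map ((baseChangeHom ι₁).map f) i).hom
        ((singularCohomology.map ℂ ℂ (conjComplexPoints ι₁ Y' : C(_, _)) i).hom z) := by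
  -- the square of continuous maps on points: `κ_{Y'} ∘ (f ⊗_{ι₁} ℂ)(ℂ) = (f ⊗_{ῑ₁} ℂ)(ℂ) ∘ κ_Y`
  have hsq : (conjComplexPoints ι₁ Y' : C(_, _)).comp (AlgPoints.mapContinuous (L := ℂ) ((baseChangeHom ι₁).map f)) =
      (AlgPoints.mapContinuous (L := ℂ) ((baseChangeHom (conjEmb ι₁)).map f)).comp (conjComplexPoints ι₁ Y : C(_, _)) := by
    ext Q : 1
    change conjComplexPoints ι₁ Y' (AlgPoints.map ((baseChangeHom ι₁).map f) Q) =
      AlgPoints.map ((baseChangeHom (conjEmb ι₁)).map f) (conjComplexPoints ι₁ Y Q)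
    rw [AlgPoints.map_apply, AlgPoints.map_apply]
    exact conjPoints_natural ι₁ (conjEmb ι₁) starRingAut (conjEmb_eq ι₁) continuous_starRingAut continuous_starRingAut_symm f Q
  have hmap := congrArg (fun φ => (singularCohomology.map ℂ ℂ φ i).hom z) hsq
  simp only [singularCohomology.map_comp, ModuleCat.hom_comp, LinearMap.comp_apply] at hmap
  exact hmap.symm

/-- **Step (3), injectivity**: pull-back along the homeomorphism `κ_Y` is injective (★ `singularCohomology.mapIso`).
[cite: HatcherAT2002, §3.1] -/
theorem injective_singularCohomology_map_conjComplexPoints (Y : SchemeOver L) (i : ℕ) :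
    Function.Injective (singularCohomology.map ℂ ℂ
      (conjComplexPoints ι₁ Y : C(ComplexPoints ((baseChangeHom ι₁).obj Y), ComplexPoints ((baseChangeHom (conjEmb ι₁)).obj Y))) i).hom :=
  (singularCohomology.mapIso ℂ ℂ (conjComplexPoints ι₁ Y) i).toLinearEquiv.injective

end ConjPoints

/-! ## §4 The transport -/

section Transport

variable {F : CMField} {ι₁ : F →+* ℂ} {Jstar : Matrix (Fin 2) (Fin 2) (F : Type)}
  {K₀ : C5.OpenCompactSubgroup ↥(finAdelic ↥(maximalRealSubfield (F : Type)) (F : Type) (IsCMField.complexConj (F : Type)) 2 Jstar)}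
  (S : RecordSystemGS (F : Type) Jstar ι₁ K₀) (hU7ₛ : S.HeckeTranslateDefinedOver) (h4 : 4 ≤ Module.finrank ℚ (F : Type)) (isoₛ : ℕ → Prop)

/-- **M5-tr — THE GS BETTI LEVELS EMBED HECKE-NATURALLY INTO THE RECORD's `H¹((M_K ⊗_{ι₁} ℂ)(ℂ); ℂ)`.**  There are INJECTIVE `ℂ`-linear maps
`tr_K : H¹_{B,ι₁}(A_K, ℂ) → H¹((M_K ⊗_{F,ι₁} ℂ)(ℂ); ℂ)` (`A_K = Alb(M_K ⊗_c F)`, the §4.2 datum `sec42DataGS` of the record) with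
`tr_K (Alb(T_g)^* y) = (T_g ⊗_{ι₁} ℂ)(ℂ)^* (tr_{K'} y)` for every Hecke translate `T_g : M_K ⟶ M_{K'}` of the record (`g⁻¹Kg ⊆ K'`;
`recordHeckeTranslateGS`, whose `c`-base-change IS `T.tr g`, ★ `sec42HeckeTranslatesGS_tr`): `tr_K := κ_K^* ∘ (Θ_K⁻¹)^* ∘ albaneseH1Cmp X_K A_K`
(steps (1)(2)(3)).  [Liu2021, Lem. 2.4 (1)] ∘ [Deligne1982, §1]. [cite: Liu2021, Lem. 2.4 (1) (FJcycle.tex l. 1210–1228); §4.2 l. 2064–2081]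
[cite: Deligne1982, §1] [cite: Milne2005ShimuraVarieties, §13 p. 118] -/
theorem exists_bettiLevelRecordTransport :
    ∃ tr : ∀ K : C5.SmallLevel K₀,
        (sec42DataGS S h4 isoₛ).bettiH1 ι₁ K →ₗ[ℂ] complexBetti ((baseChangeHom ι₁).obj (S.M.obj K)) 1,
      (∀ K, Function.Injective (tr K)) ∧
      ∀ (g : (sec42DataGS S h4 isoₛ).G) (K K' : C5.SmallLevel K₀) (h : C5.HeckeLE g K K')
        (y : (sec42DataGS S h4 isoₛ).bettiH1 ι₁ K'),
        tr K (bettiPullAlong ι₁ ((sec42HeckeTranslatesGS S hU7ₛ h4 isoₛ).albTr g K K' h) y) =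
          (complexBetti.map ((baseChangeHom ι₁).map (recordHeckeTranslateGS S hU7ₛ g K K' h)) 1).hom (tr K' y) := by
  letI : Algebra (F : Type) ℂ := algebraAlong (F : Type) ι₁
  -- the three steps as linear maps
  let e₁ : ∀ K : C5.SmallLevel K₀, (sec42DataGS S h4 isoₛ).bettiH1 ι₁ K →ₗ[ℂ]
      complexBetti ((baseChangeHom ι₁).obj ((baseChangeHom (cmConjRingHom (F : Type))).obj (S.M.obj K))) 1 :=
    fun K => albaneseH1Cmp ((sec42DataGS S h4 isoₛ).X K) ((sec42DataGS S h4 isoₛ).alb K)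
  let e₂ : ∀ K : C5.SmallLevel K₀,
      complexBetti ((baseChangeHom ι₁).obj ((baseChangeHom (cmConjRingHom (F : Type))).obj (S.M.obj K))) 1 →ₗ[ℂ]
      complexBetti ((baseChangeHom (conjEmb ι₁)).obj (S.M.obj K)) 1 :=
    fun K => (complexBetti.map (baseChangeHomObjIsoOfComp (cmConjRingHom (F : Type)) ι₁ (conjEmb ι₁)
      (comp_cmConjRingHom_eq_conjEmb (F : Type) ι₁) (S.M.obj K)).inv 1).hom
  let e₃ : ∀ K : C5.SmallLevel K₀, complexBetti ((baseChangeHom (conjEmb ι₁)).obj (S.M.obj K)) 1 →ₗ[ℂ]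
      complexBetti ((baseChangeHom ι₁).obj (S.M.obj K)) 1 :=
    fun K => (singularCohomology.map ℂ ℂ (conjComplexPoints ι₁ (S.M.obj K) : C(_, _)) 1).hom
  refine ⟨fun K => (e₃ K) ∘ₗ (e₂ K) ∘ₗ (e₁ K), fun K => ?_, fun g K K' h y => ?_⟩
  · exact (injective_singularCohomology_map_conjComplexPoints ι₁ (S.M.obj K) 1).comp
      ((injective_complexBetti_map_conjModelIso_inv (F : Type) ι₁ (S.M.obj K) 1).comp
        (injective_albaneseH1Cmp S h4 isoₛ K))
  · simp only [LinearMap.comp_apply]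
    have h1 : e₁ K (bettiPullAlong ι₁ ((sec42HeckeTranslatesGS S hU7ₛ h4 isoₛ).albTr g K K' h) y) =
        (complexBetti.map ((baseChangeHom ι₁).map ((baseChangeHom (cmConjRingHom (F : Type))).map
          (recordHeckeTranslateGS S hU7ₛ g K K' h))) 1).hom (e₁ K' y) :=
      albaneseH1Cmp_albTr S hU7ₛ h4 isoₛ g K K' h y
    rw [h1]
    have h2 := complexBetti_map_conjModelIso_inv_natural (F : Type) ι₁ (recordHeckeTranslateGS S hU7ₛ g K K' h) 1 (e₁ K' y)
    change e₃ K ((complexBetti.map (baseChangeHomObjIsoOfComp (cmConjRingHom (F : Type)) ι₁ (conjEmb ι₁)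
        (comp_cmConjRingHom_eq_conjEmb (F : Type) ι₁) (S.M.obj K)).inv 1).hom
      ((complexBetti.map ((baseChangeHom ι₁).map ((baseChangeHom (cmConjRingHom (F : Type))).map
        (recordHeckeTranslateGS S hU7ₛ g K K' h))) 1).hom (e₁ K' y))) = _
    rw [h2]
    exact singularCohomology_map_conjComplexPoints_natural ι₁ (recordHeckeTranslateGS S hU7ₛ g K K' h) 1 (e₂ K' (e₁ K' y))

end Transport

end Summit.HodgeConjecture.HodgeConjecture.Cruxes.HLiu418.BettiLevelRecordTransport

end
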